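import Summits.HodgeConjecture.CorCM.MultiFieldWeilThreePerFieldFactors
import Summits.HodgeConjecture.CorCM.MultiFieldWeilQuadraticSexticClosures
import HarnessLib

/-!
# MULTI-FIELD WEIL ENGINE — ON THE VARIETY, CLASSES PER FIELD: a complex abelian variety of CM type with simple isogeny factors of dimension `≤ 3`, at most ONE isogeny class of
# threefold factors per sextic CM field WITH an imaginary quadratic subfield, at most THREE per sextic CM field WITHOUT, and no dihedral surface triple, satisfies the Hodge
# conjecture together with everything dominated by its powers — given ONLY Markman's fourfold theorem

Cell `pub-hodgecm2` (COR-CM), seat b30 gen 37 (2026-08-25); count-neutral own lane MULTI-FIELD WEIL ENGINE (stem `MultiFieldWeil*`).  Theorems only; no definition, no named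
fact, no `sorry`.  HONEST FRAMING: conditional on the displayed Markman fourfold binder only; `HC_CM` is NOT proved and not asserted — a statement about a NAMED CLASS of CM
abelian varieties.

This is `CorCM/MultiFieldWeilThreePerFieldFactors.lean` with hypothesis (b) «non-isogenous threefold factors sharing an imaginary quadratic field have CM fields with DIFFERENT
GALOIS CLOSURES» replaced, through the 𝔖₃ lemma `CorCM/MultiFieldWeilQuadraticSexticClosures.lean` (sharing + one closure ⟹ isomorphic), by «… have NON-ISOMORPHIC CM fields»,
and then read per isomorphism class of fields.

THE STATEMENT (**`hodgeConjectureFor_of_avDominatedBy_powSucc_of_isOfCMType_of_classesPerField_of_markman`**).  Let `X` be a complex abelian variety of CM type such that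
(a) every simple isogeny factor has dimension `≤ 3`; (b₁) two simple threefold factors with ISOMORPHIC CM fields having a totally complex quadratic subfield are ISOGENOUS
(all CM realisations) — at most ONE isogeny class of threefold factors per sextic CM field with an imaginary quadratic subfield; (b₃) no FOUR pairwise non-isogenous simple
threefold factors have pairwise isomorphic CM fields — at most THREE classes per sextic CM field; (c) no three pairwise non-isogenous simple surface factors have CM fields
sharing one Galois closure.  Then EVERY complex abelian variety dominated by a power `X^{N+1}` satisfies the Hodge conjecture, GIVEN ONLY
`Markman2025_weilClasses_algebraic_abelianFourfold`.  Compare seat b16's UNCONDITIONAL classification (`CorCM/CMAbelianFactorsDimLeThreeClassification`): all powers of `X`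
are divisor-generated iff (i′) no imaginary quadratic field is shared by two non-isogenous simple factors, (ii′) at most three threefold classes per endomorphism field, (iii′) no
dihedral surface triple.  Here (i′) is relaxed EXACTLY to (b₁): CM elliptic factors and threefold factors with pairwise non-isomorphic sextic fields may share imaginary quadratic
fields freely (the Weil-type world, where Markman's theorem supplies the exceptional classes).  Also: the «sharing ⟹ `Hom(K₀, K₁) = ∅`» form
(`…_of_sharedIsEmptyRingHom_threePerField_of_markman`), which CONTAINS both `CorCM/MultiFieldWeilNoClosureTripleFactors.lean` ((b′) no closure triple ⟹ (b₃)) and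
`CorCM/MultiFieldWeilThreePerFieldFactors.lean` (different closures ⟹ `Hom = ∅`); §2 the WITNESSED form (hypotheses checked on one CM realisation per factor).

HONEST LIMITS (not claimed): two or three isogeny classes of threefold factors over ONE field `k·F⁺` (three classes of a non-Galois `k·F⁺` carry an exceptional Hodge class not
of Weil type; one such pair with elliptic factors only is `CorCM/MultiFieldWeilAnyTwoSimpleThreefoldsAnyCurves`); four classes of one sextic field; the dihedral surface triple;
simple factors of dimension `≥ 4`.

[cite: MoonenZarhin1999LowDim, Thm. (0.1), Thm. (0.2), §3 (3.1), Cor. (3.9), §5 (5.2)] [cite: Markman2025SurveySecant, Thm. 1.2] [cite: Milne1999LefschetzClasses, §1 Prop. 1.1]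
[cite: MilneCM2006, Ch. I Prop. 3.13] [cite: Dodson1984, §5.1.2 Theorem] [cite: MumfordAV1970, §19 Thm. 1, Cor. 1–2 and p. 169] [cite: Lang2002, I §6 Thm. 6.4 (ii); VI §1 Thm. 1.1]
-/

noncomputable section

open CategoryTheory CategoryTheory.Limits NumberField IntermediateField

namespace Summit.HodgeConjecture.CorCM.MultiFieldWeil

open Literature.AlgebraicGeometry Literature.AlgebraicGeometry.Motives Literature.AlgebraicGeometry.HodgeTheory
open Literature.AlgebraicGeometry.Motives.AbelianVariety
open Literature.AlgebraicGeometry.ComplexMultiplication (IsCMTypeRealisation exists_ringEquiv_forall_mem_iff_of_isIsogenous)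
open Literature.AlgebraicTopology.SingularHomology
open Literature.NumberTheory.ComplexMultiplication
open Literature.AlgebraicGeometry.Milne1999 (IsOfCMType)
open Summit.HodgeConjecture.CorCM.Domination

open scoped Classical

section OnTheVariety

variable {X : AbelianVariety ℂ}

/-- **SHARING ⟹ `Hom = ∅` (on the variety).**  `X` of CM type; (a) simple isogeny factors of dimension `≤ 3`; (b) for any two NON-isogenous simple threefold factors and all CM
realisations `B₀ ⊨ (K₀; Φ₀)`, `B₁ ⊨ (K₁; Φ₁)`: a totally complex quadratic `F ≤ K₀` embedding in `K₁` forces `Hom(K₀, K₁) = ∅`; (b₃) no four pairwise non-isogenous simple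
threefold factors with pairwise isomorphic CM fields; (c) no three pairwise non-isogenous simple surface factors with CM realisations sharing one Galois closure.  Then everything
dominated by a power `X^{N+1}` satisfies the Hodge conjecture, GIVEN ONLY `Markman2025_weilClasses_algebraic_abelianFourfold` — CONTAINS `…_of_noClosureTriple_of_markman` and
`…_of_threePerField_of_markman` (sharing + one closure ⟹ `Hom ≠ ∅`, the 𝔖₃ lemma).  `HC_CM` is NOT asserted. [cite: Milne1999LefschetzClasses, §1 Prop. 1.1]
[cite: MoonenZarhin1999LowDim, Thm. (0.1), (0.2), §3 (3.1), Cor. (3.9)] [cite: Markman2025SurveySecant, Thm. 1.2] [cite: Lang2002, I §6 Thm. 6.4 (ii); VI §1 Thm. 1.1]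
[cite: Dodson1984, §5.1.2 Theorem] -/
theorem hodgeConjectureFor_of_avDominatedBy_powSucc_of_isOfCMType_of_sharedIsEmptyRingHom_threePerField_of_markman
    (hW4 : Markman2025_weilClasses_algebraic_abelianFourfold) (hcm : IsOfCMType X)
    (h3 : ∀ B : AbelianVariety ℂ, B.IsSimple → AVDominatedBy B X → B.dim ≤ 3)
    (hT : ∀ B₀ B₁ : AbelianVariety ℂ, B₀.IsSimple → B₁.IsSimple → AVDominatedBy B₀ X → AVDominatedBy B₁ X → B₀.dim = 3 → B₁.dim = 3 → ¬ IsIsogenous B₀ B₁ →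
      ∀ (K₀ : Type) [Field K₀] [NumberField K₀] [IsCMField K₀] (Φ₀ : CMType K₀) (ι₀ : 𝓞 K₀ →+* End B₀) (θ₀ : K₀ →+* Module.End ℂ (complexBetti B₀.X 1))
        (K₁ : Type) [Field K₁] [NumberField K₁] [IsCMField K₁] (Φ₁ : CMType K₁) (ι₁ : 𝓞 K₁ →+* End B₁) (θ₁ : K₁ →+* Module.End ℂ (complexBetti B₁.X 1)),
        IsCMTypeRealisation Φ₀ B₀ ι₀ θ₀ → IsCMTypeRealisation Φ₁ B₁ ι₁ θ₁ →
          ((∃ F : IntermediateField ℚ K₀, Module.finrank ℚ F = 2 ∧ IsTotallyComplex F ∧ Nonempty (F →+* K₁)) → IsEmpty (K₀ →+* K₁)))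
    (hT4 : ∀ B₀ B₁ B₂ B₃ : AbelianVariety ℂ, B₀.IsSimple → B₁.IsSimple → B₂.IsSimple → B₃.IsSimple →
      AVDominatedBy B₀ X → AVDominatedBy B₁ X → AVDominatedBy B₂ X → AVDominatedBy B₃ X → B₀.dim = 3 → B₁.dim = 3 → B₂.dim = 3 → B₃.dim = 3 →
      ¬ IsIsogenous B₀ B₁ → ¬ IsIsogenous B₀ B₂ → ¬ IsIsogenous B₀ B₃ → ¬ IsIsogenous B₁ B₂ → ¬ IsIsogenous B₁ B₃ → ¬ IsIsogenous B₂ B₃ →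
      ∀ (K₀ : Type) [Field K₀] [NumberField K₀] [IsCMField K₀] (Φ₀ : CMType K₀) (ι₀ : 𝓞 K₀ →+* End B₀) (θ₀ : K₀ →+* Module.End ℂ (complexBetti B₀.X 1))
        (K₁ : Type) [Field K₁] [NumberField K₁] [IsCMField K₁] (Φ₁ : CMType K₁) (ι₁ : 𝓞 K₁ →+* End B₁) (θ₁ : K₁ →+* Module.End ℂ (complexBetti B₁.X 1))
        (K₂ : Type) [Field K₂] [NumberField K₂] [IsCMField K₂] (Φ₂ : CMType K₂) (ι₂ : 𝓞 K₂ →+* End B₂) (θ₂ : K₂ →+* Module.End ℂ (complexBetti B₂.X 1))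
        (K₃ : Type) [Field K₃] [NumberField K₃] [IsCMField K₃] (Φ₃ : CMType K₃) (ι₃ : 𝓞 K₃ →+* End B₃) (θ₃ : K₃ →+* Module.End ℂ (complexBetti B₃.X 1)),
        IsCMTypeRealisation Φ₀ B₀ ι₀ θ₀ → IsCMTypeRealisation Φ₁ B₁ ι₁ θ₁ → IsCMTypeRealisation Φ₂ B₂ ι₂ θ₂ → IsCMTypeRealisation Φ₃ B₃ ι₃ θ₃ →
          ¬ (Nonempty (K₁ ≃+* K₀) ∧ Nonempty (K₂ ≃+* K₀) ∧ Nonempty (K₃ ≃+* K₀)))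
    (hS : ∀ B₀ B₁ B₂ : AbelianVariety ℂ, B₀.IsSimple → B₁.IsSimple → B₂.IsSimple → AVDominatedBy B₀ X → AVDominatedBy B₁ X → AVDominatedBy B₂ X →
      B₀.dim = 2 → B₁.dim = 2 → B₂.dim = 2 → ¬ IsIsogenous B₀ B₁ → ¬ IsIsogenous B₀ B₂ → ¬ IsIsogenous B₁ B₂ →
      ∀ (K₀ : Type) [Field K₀] [NumberField K₀] [IsCMField K₀] (Φ₀ : CMType K₀) (ι₀ : 𝓞 K₀ →+* End B₀) (θ₀ : K₀ →+* Module.End ℂ (complexBetti B₀.X 1))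
        (K₁ : Type) [Field K₁] [NumberField K₁] [IsCMField K₁] (Φ₁ : CMType K₁) (ι₁ : 𝓞 K₁ →+* End B₁) (θ₁ : K₁ →+* Module.End ℂ (complexBetti B₁.X 1))
        (K₂ : Type) [Field K₂] [NumberField K₂] [IsCMField K₂] (Φ₂ : CMType K₂) (ι₂ : 𝓞 K₂ →+* End B₂) (θ₂ : K₂ →+* Module.End ℂ (complexBetti B₂.X 1)),
        IsCMTypeRealisation Φ₀ B₀ ι₀ θ₀ → IsCMTypeRealisation Φ₁ B₁ ι₁ θ₁ → IsCMTypeRealisation Φ₂ B₂ ι₂ θ₂ →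
          ¬ (normalClosure ℚ K₀ ℂ = normalClosure ℚ K₁ ℂ ∧ normalClosure ℚ K₁ ℂ = normalClosure ℚ K₂ ℂ))
    {B : AbelianVariety ℂ} {N : ℕ} (hB : AVDominatedBy B (X.powSucc N)) : HodgeConjectureFor B.dim B.X := by
  refine hodgeConjectureFor_of_avDominatedBy_powSucc_of_isOfCMType_of_threePerField_of_markman hW4 hcm h3 ?_ hT4 hS hB
  intro B₀ B₁ hs₀ hs₁ hd₀ hd₁ h3₀ h3₁ hni K₀ _ _ _ Φ₀ ι₀ θ₀ K₁ _ _ _ Φ₁ ι₁ θ₁ hA₀ hA₁ hsh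
  have h6₀ : Module.finrank ℚ K₀ = 6 := by have := Literature.AlgebraicGeometry.Pohlmann1968.finrank_eq_two_mul_dim_of_isCMTypeRealisation hA₀; omega
  have h6₁ : Module.finrank ℚ K₁ = 6 := by have := Literature.AlgebraicGeometry.Pohlmann1968.finrank_eq_two_mul_dim_of_isCMTypeRealisation hA₁; omega
  exact normalClosure_ne_of_sharedQuadratic_of_isEmpty_ringHom h6₀ h6₁ hsh
    (hT B₀ B₁ hs₀ hs₁ hd₀ hd₁ h3₀ h3₁ hni K₀ Φ₀ ι₀ θ₀ K₁ Φ₁ ι₁ θ₁ hA₀ hA₁ hsh)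

/-- **MAIN THEOREM (on the variety) — CLASSES PER FIELD: AT MOST ONE ISOGENY CLASS OF THREEFOLD FACTORS PER SEXTIC CM FIELD WITH AN IMAGINARY QUADRATIC SUBFIELD, AT MOST
THREE PER SEXTIC CM FIELD WITHOUT, NO DIHEDRAL SURFACE TRIPLE, ANY ELLIPTIC FACTORS — given ONLY Markman's fourfold theorem.**  `X` of CM type; (a) simple isogeny factors of
dimension `≤ 3`; (b₁) for any two simple threefold factors and all CM realisations `B₀ ⊨ (K₀; Φ₀)`, `B₁ ⊨ (K₁; Φ₁)`: if `K₀` has a totally complex quadratic subfield and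
`K₁ ≃ K₀`, then `B₀`, `B₁` are isogenous; (b₃) no four pairwise non-isogenous simple threefold factors with pairwise isomorphic CM fields (all realisations); (c) no three pairwise
non-isogenous simple surface factors with CM realisations sharing one Galois closure.  Then everything dominated by a power `X^{N+1}` satisfies the Hodge conjecture, GIVEN ONLY
`Markman2025_weilClasses_algebraic_abelianFourfold`.  `HC_CM` is NOT asserted. [cite: Milne1999LefschetzClasses, §1 Prop. 1.1] [cite: MoonenZarhin1999LowDim, Thm. (0.1), (0.2), §3 (3.1), Cor. (3.9)]
[cite: Markman2025SurveySecant, Thm. 1.2] [cite: Lang2002, I §6 Thm. 6.4 (ii); VI §1 Thm. 1.1] [cite: Dodson1984, §5.1.2 Theorem] [cite: MumfordAV1970, §19 Thm. 1, Cor. 1–2] -/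
theorem hodgeConjectureFor_of_avDominatedBy_powSucc_of_isOfCMType_of_classesPerField_of_markman
    (hW4 : Markman2025_weilClasses_algebraic_abelianFourfold) (hcm : IsOfCMType X)
    (h3 : ∀ B : AbelianVariety ℂ, B.IsSimple → AVDominatedBy B X → B.dim ≤ 3)
    (hT1 : ∀ B₀ B₁ : AbelianVariety ℂ, B₀.IsSimple → B₁.IsSimple → AVDominatedBy B₀ X → AVDominatedBy B₁ X → B₀.dim = 3 → B₁.dim = 3 →
      ∀ (K₀ : Type) [Field K₀] [NumberField K₀] [IsCMField K₀] (Φ₀ : CMType K₀) (ι₀ : 𝓞 K₀ →+* End B₀) (θ₀ : K₀ →+* Module.End ℂ (complexBetti B₀.X 1))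
        (K₁ : Type) [Field K₁] [NumberField K₁] [IsCMField K₁] (Φ₁ : CMType K₁) (ι₁ : 𝓞 K₁ →+* End B₁) (θ₁ : K₁ →+* Module.End ℂ (complexBetti B₁.X 1)),
        IsCMTypeRealisation Φ₀ B₀ ι₀ θ₀ → IsCMTypeRealisation Φ₁ B₁ ι₁ θ₁ →
          (∃ F : IntermediateField ℚ K₀, Module.finrank ℚ F = 2 ∧ IsTotallyComplex F) → Nonempty (K₁ ≃+* K₀) → IsIsogenous B₀ B₁)
    (hT4 : ∀ B₀ B₁ B₂ B₃ : AbelianVariety ℂ, B₀.IsSimple → B₁.IsSimple → B₂.IsSimple → B₃.IsSimple →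
      AVDominatedBy B₀ X → AVDominatedBy B₁ X → AVDominatedBy B₂ X → AVDominatedBy B₃ X → B₀.dim = 3 → B₁.dim = 3 → B₂.dim = 3 → B₃.dim = 3 →
      ¬ IsIsogenous B₀ B₁ → ¬ IsIsogenous B₀ B₂ → ¬ IsIsogenous B₀ B₃ → ¬ IsIsogenous B₁ B₂ → ¬ IsIsogenous B₁ B₃ → ¬ IsIsogenous B₂ B₃ →
      ∀ (K₀ : Type) [Field K₀] [NumberField K₀] [IsCMField K₀] (Φ₀ : CMType K₀) (ι₀ : 𝓞 K₀ →+* End B₀) (θ₀ : K₀ →+* Module.End ℂ (complexBetti B₀.X 1))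
        (K₁ : Type) [Field K₁] [NumberField K₁] [IsCMField K₁] (Φ₁ : CMType K₁) (ι₁ : 𝓞 K₁ →+* End B₁) (θ₁ : K₁ →+* Module.End ℂ (complexBetti B₁.X 1))
        (K₂ : Type) [Field K₂] [NumberField K₂] [IsCMField K₂] (Φ₂ : CMType K₂) (ι₂ : 𝓞 K₂ →+* End B₂) (θ₂ : K₂ →+* Module.End ℂ (complexBetti B₂.X 1))
        (K₃ : Type) [Field K₃] [NumberField K₃] [IsCMField K₃] (Φ₃ : CMType K₃) (ι₃ : 𝓞 K₃ →+* End B₃) (θ₃ : K₃ →+* Module.End ℂ (complexBetti B₃.X 1)),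
        IsCMTypeRealisation Φ₀ B₀ ι₀ θ₀ → IsCMTypeRealisation Φ₁ B₁ ι₁ θ₁ → IsCMTypeRealisation Φ₂ B₂ ι₂ θ₂ → IsCMTypeRealisation Φ₃ B₃ ι₃ θ₃ →
          ¬ (Nonempty (K₁ ≃+* K₀) ∧ Nonempty (K₂ ≃+* K₀) ∧ Nonempty (K₃ ≃+* K₀)))
    (hS : ∀ B₀ B₁ B₂ : AbelianVariety ℂ, B₀.IsSimple → B₁.IsSimple → B₂.IsSimple → AVDominatedBy B₀ X → AVDominatedBy B₁ X → AVDominatedBy B₂ X →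
      B₀.dim = 2 → B₁.dim = 2 → B₂.dim = 2 → ¬ IsIsogenous B₀ B₁ → ¬ IsIsogenous B₀ B₂ → ¬ IsIsogenous B₁ B₂ →
      ∀ (K₀ : Type) [Field K₀] [NumberField K₀] [IsCMField K₀] (Φ₀ : CMType K₀) (ι₀ : 𝓞 K₀ →+* End B₀) (θ₀ : K₀ →+* Module.End ℂ (complexBetti B₀.X 1))
        (K₁ : Type) [Field K₁] [NumberField K₁] [IsCMField K₁] (Φ₁ : CMType K₁) (ι₁ : 𝓞 K₁ →+* End B₁) (θ₁ : K₁ →+* Module.End ℂ (complexBetti B₁.X 1))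
        (K₂ : Type) [Field K₂] [NumberField K₂] [IsCMField K₂] (Φ₂ : CMType K₂) (ι₂ : 𝓞 K₂ →+* End B₂) (θ₂ : K₂ →+* Module.End ℂ (complexBetti B₂.X 1)),
        IsCMTypeRealisation Φ₀ B₀ ι₀ θ₀ → IsCMTypeRealisation Φ₁ B₁ ι₁ θ₁ → IsCMTypeRealisation Φ₂ B₂ ι₂ θ₂ →
          ¬ (normalClosure ℚ K₀ ℂ = normalClosure ℚ K₁ ℂ ∧ normalClosure ℚ K₁ ℂ = normalClosure ℚ K₂ ℂ))
    {B : AbelianVariety ℂ} {N : ℕ} (hB : AVDominatedBy B (X.powSucc N)) : HodgeConjectureFor B.dim B.X := by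
  refine hodgeConjectureFor_of_avDominatedBy_powSucc_of_isOfCMType_of_threePerField_of_markman hW4 hcm h3 ?_ hT4 hS hB
  intro B₀ B₁ hs₀ hs₁ hd₀ hd₁ h3₀ h3₁ hni K₀ _ _ _ Φ₀ ι₀ θ₀ K₁ _ _ _ Φ₁ ι₁ θ₁ hA₀ hA₁ hsh
  have h6₀ : Module.finrank ℚ K₀ = 6 := by have := Literature.AlgebraicGeometry.Pohlmann1968.finrank_eq_two_mul_dim_of_isCMTypeRealisation hA₀; omega
  have h6₁ : Module.finrank ℚ K₁ = 6 := by have := Literature.AlgebraicGeometry.Pohlmann1968.finrank_eq_two_mul_dim_of_isCMTypeRealisation hA₁; omega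
  refine normalClosure_ne_of_sharedQuadratic_of_isEmpty_ringEquiv h6₀ h6₁ hsh ⟨fun ε => hni ?_⟩
  obtain ⟨F, hF2, hFtc, -⟩ := hsh
  exact hT1 B₀ B₁ hs₀ hs₁ hd₀ hd₁ h3₀ h3₁ K₀ Φ₀ ι₀ θ₀ K₁ Φ₁ ι₁ θ₁ hA₀ hA₁ ⟨F, hF2, hFtc⟩ ⟨ε⟩

/-- **The Hodge conjecture for `X` itself and all its powers**, under (a), (b₁), (b₃), (c), given only Markman's fourfold theorem. [cite: MoonenZarhin1999LowDim, Thm. (0.1), (0.2)]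
[cite: Markman2025SurveySecant, Thm. 1.2] [cite: Lang2002, I §6 Thm. 6.4 (ii); VI §1 Thm. 1.1] -/
theorem hodgeConjectureFor_powSucc_of_isOfCMType_of_classesPerField_of_markman (hW4 : Markman2025_weilClasses_algebraic_abelianFourfold)
    (hcm : IsOfCMType X) (h3 : ∀ B : AbelianVariety ℂ, B.IsSimple → AVDominatedBy B X → B.dim ≤ 3)
    (hT1 : ∀ B₀ B₁ : AbelianVariety ℂ, B₀.IsSimple → B₁.IsSimple → AVDominatedBy B₀ X → AVDominatedBy B₁ X → B₀.dim = 3 → B₁.dim = 3 →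
      ∀ (K₀ : Type) [Field K₀] [NumberField K₀] [IsCMField K₀] (Φ₀ : CMType K₀) (ι₀ : 𝓞 K₀ →+* End B₀) (θ₀ : K₀ →+* Module.End ℂ (complexBetti B₀.X 1))
        (K₁ : Type) [Field K₁] [NumberField K₁] [IsCMField K₁] (Φ₁ : CMType K₁) (ι₁ : 𝓞 K₁ →+* End B₁) (θ₁ : K₁ →+* Module.End ℂ (complexBetti B₁.X 1)),
        IsCMTypeRealisation Φ₀ B₀ ι₀ θ₀ → IsCMTypeRealisation Φ₁ B₁ ι₁ θ₁ →
          (∃ F : IntermediateField ℚ K₀, Module.finrank ℚ F = 2 ∧ IsTotallyComplex F) → Nonempty (K₁ ≃+* K₀) → IsIsogenous B₀ B₁)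
    (hT4 : ∀ B₀ B₁ B₂ B₃ : AbelianVariety ℂ, B₀.IsSimple → B₁.IsSimple → B₂.IsSimple → B₃.IsSimple →
      AVDominatedBy B₀ X → AVDominatedBy B₁ X → AVDominatedBy B₂ X → AVDominatedBy B₃ X → B₀.dim = 3 → B₁.dim = 3 → B₂.dim = 3 → B₃.dim = 3 →
      ¬ IsIsogenous B₀ B₁ → ¬ IsIsogenous B₀ B₂ → ¬ IsIsogenous B₀ B₃ → ¬ IsIsogenous B₁ B₂ → ¬ IsIsogenous B₁ B₃ → ¬ IsIsogenous B₂ B₃ →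
      ∀ (K₀ : Type) [Field K₀] [NumberField K₀] [IsCMField K₀] (Φ₀ : CMType K₀) (ι₀ : 𝓞 K₀ →+* End B₀) (θ₀ : K₀ →+* Module.End ℂ (complexBetti B₀.X 1))
        (K₁ : Type) [Field K₁] [NumberField K₁] [IsCMField K₁] (Φ₁ : CMType K₁) (ι₁ : 𝓞 K₁ →+* End B₁) (θ₁ : K₁ →+* Module.End ℂ (complexBetti B₁.X 1))
        (K₂ : Type) [Field K₂] [NumberField K₂] [IsCMField K₂] (Φ₂ : CMType K₂) (ι₂ : 𝓞 K₂ →+* End B₂) (θ₂ : K₂ →+* Module.End ℂ (complexBetti B₂.X 1))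
        (K₃ : Type) [Field K₃] [NumberField K₃] [IsCMField K₃] (Φ₃ : CMType K₃) (ι₃ : 𝓞 K₃ →+* End B₃) (θ₃ : K₃ →+* Module.End ℂ (complexBetti B₃.X 1)),
        IsCMTypeRealisation Φ₀ B₀ ι₀ θ₀ → IsCMTypeRealisation Φ₁ B₁ ι₁ θ₁ → IsCMTypeRealisation Φ₂ B₂ ι₂ θ₂ → IsCMTypeRealisation Φ₃ B₃ ι₃ θ₃ →
          ¬ (Nonempty (K₁ ≃+* K₀) ∧ Nonempty (K₂ ≃+* K₀) ∧ Nonempty (K₃ ≃+* K₀)))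
    (hS : ∀ B₀ B₁ B₂ : AbelianVariety ℂ, B₀.IsSimple → B₁.IsSimple → B₂.IsSimple → AVDominatedBy B₀ X → AVDominatedBy B₁ X → AVDominatedBy B₂ X →
      B₀.dim = 2 → B₁.dim = 2 → B₂.dim = 2 → ¬ IsIsogenous B₀ B₁ → ¬ IsIsogenous B₀ B₂ → ¬ IsIsogenous B₁ B₂ →
      ∀ (K₀ : Type) [Field K₀] [NumberField K₀] [IsCMField K₀] (Φ₀ : CMType K₀) (ι₀ : 𝓞 K₀ →+* End B₀) (θ₀ : K₀ →+* Module.End ℂ (complexBetti B₀.X 1))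
        (K₁ : Type) [Field K₁] [NumberField K₁] [IsCMField K₁] (Φ₁ : CMType K₁) (ι₁ : 𝓞 K₁ →+* End B₁) (θ₁ : K₁ →+* Module.End ℂ (complexBetti B₁.X 1))
        (K₂ : Type) [Field K₂] [NumberField K₂] [IsCMField K₂] (Φ₂ : CMType K₂) (ι₂ : 𝓞 K₂ →+* End B₂) (θ₂ : K₂ →+* Module.End ℂ (complexBetti B₂.X 1)),
        IsCMTypeRealisation Φ₀ B₀ ι₀ θ₀ → IsCMTypeRealisation Φ₁ B₁ ι₁ θ₁ → IsCMTypeRealisation Φ₂ B₂ ι₂ θ₂ →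
          ¬ (normalClosure ℚ K₀ ℂ = normalClosure ℚ K₁ ℂ ∧ normalClosure ℚ K₁ ℂ = normalClosure ℚ K₂ ℂ))
    (N : ℕ) : HodgeConjectureFor (X.powSucc N).dim (X.powSucc N).X :=
  hodgeConjectureFor_of_avDominatedBy_powSucc_of_isOfCMType_of_classesPerField_of_markman hW4 hcm h3 hT1 hT4 hS (AVDominatedBy.refl _)

end OnTheVariety

/-! ## §2 The witnessed form: hypotheses checked on one CM realisation per factor -/

section Witnessed

variable {X : AbelianVariety ℂ}

/-- **MAIN THEOREM (on the variety, witnessed).**  `X` of CM type; (a) simple isogeny factors of dimension `≤ 3`; (b₁) for any two NON-isogenous simple threefold factors there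
EXIST CM realisations `B₀ ⊨ (K₀; Φ₀)`, `B₁ ⊨ (K₁; Φ₁)` such that `K₁ ≄ K₀` whenever `K₀` has a totally complex quadratic subfield; (b₃) for any four pairwise non-isogenous simple
threefold factors there EXIST CM realisations whose fields are not all isomorphic to the first; (c) for any three pairwise non-isogenous simple surface factors there EXIST CM
realisations whose fields do not share one Galois closure.  Then everything dominated by a power `X^{N+1}` satisfies the Hodge conjecture, given ONLY Markman's fourfold theorem
(the CM field of a simple CM abelian variety is unique up to isomorphism; (b₁), (b₃), (c) transport along field isomorphisms).  `HC_CM` is NOT asserted.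
[cite: MilneCM2006, Ch. I Prop. 3.13] [cite: Milne1999LefschetzClasses, §1 Prop. 1.1] [cite: MoonenZarhin1999LowDim, Thm. (0.1), (0.2), §3 (3.1), Cor. (3.9)]
[cite: Markman2025SurveySecant, Thm. 1.2] [cite: Lang2002, I §6 Thm. 6.4 (ii); VI §1 Thm. 1.1 and Cor. 1.6] -/
theorem hodgeConjectureFor_of_avDominatedBy_powSucc_of_isOfCMType_of_witnessed_classesPerField_of_markman
    (hW4 : Markman2025_weilClasses_algebraic_abelianFourfold) (hcm : IsOfCMType X)
    (h3 : ∀ B : AbelianVariety ℂ, B.IsSimple → AVDominatedBy B X → B.dim ≤ 3)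
    (hT1 : ∀ B₀ B₁ : AbelianVariety ℂ, B₀.IsSimple → B₁.IsSimple → AVDominatedBy B₀ X → AVDominatedBy B₁ X → B₀.dim = 3 → B₁.dim = 3 → ¬ IsIsogenous B₀ B₁ →
      ∃ (K₀ : Type) (_ : Field K₀) (_ : NumberField K₀) (_ : IsCMField K₀) (Φ₀ : CMType K₀) (ι₀ : 𝓞 K₀ →+* End B₀) (θ₀ : K₀ →+* Module.End ℂ (complexBetti B₀.X 1))
        (K₁ : Type) (_ : Field K₁) (_ : NumberField K₁) (_ : IsCMField K₁) (Φ₁ : CMType K₁) (ι₁ : 𝓞 K₁ →+* End B₁) (θ₁ : K₁ →+* Module.End ℂ (complexBetti B₁.X 1)),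
        IsCMTypeRealisation Φ₀ B₀ ι₀ θ₀ ∧ IsCMTypeRealisation Φ₁ B₁ ι₁ θ₁ ∧
          ((∃ F : IntermediateField ℚ K₀, Module.finrank ℚ F = 2 ∧ IsTotallyComplex F) → IsEmpty (K₁ ≃+* K₀)))
    (hT4 : ∀ B₀ B₁ B₂ B₃ : AbelianVariety ℂ, B₀.IsSimple → B₁.IsSimple → B₂.IsSimple → B₃.IsSimple →
      AVDominatedBy B₀ X → AVDominatedBy B₁ X → AVDominatedBy B₂ X → AVDominatedBy B₃ X → B₀.dim = 3 → B₁.dim = 3 → B₂.dim = 3 → B₃.dim = 3 →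
      ¬ IsIsogenous B₀ B₁ → ¬ IsIsogenous B₀ B₂ → ¬ IsIsogenous B₀ B₃ → ¬ IsIsogenous B₁ B₂ → ¬ IsIsogenous B₁ B₃ → ¬ IsIsogenous B₂ B₃ →
      ∃ (K₀ : Type) (_ : Field K₀) (_ : NumberField K₀) (_ : IsCMField K₀) (Φ₀ : CMType K₀) (ι₀ : 𝓞 K₀ →+* End B₀) (θ₀ : K₀ →+* Module.End ℂ (complexBetti B₀.X 1))
        (K₁ : Type) (_ : Field K₁) (_ : NumberField K₁) (_ : IsCMField K₁) (Φ₁ : CMType K₁) (ι₁ : 𝓞 K₁ →+* End B₁) (θ₁ : K₁ →+* Module.End ℂ (complexBetti B₁.X 1))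
        (K₂ : Type) (_ : Field K₂) (_ : NumberField K₂) (_ : IsCMField K₂) (Φ₂ : CMType K₂) (ι₂ : 𝓞 K₂ →+* End B₂) (θ₂ : K₂ →+* Module.End ℂ (complexBetti B₂.X 1))
        (K₃ : Type) (_ : Field K₃) (_ : NumberField K₃) (_ : IsCMField K₃) (Φ₃ : CMType K₃) (ι₃ : 𝓞 K₃ →+* End B₃) (θ₃ : K₃ →+* Module.End ℂ (complexBetti B₃.X 1)),
        IsCMTypeRealisation Φ₀ B₀ ι₀ θ₀ ∧ IsCMTypeRealisation Φ₁ B₁ ι₁ θ₁ ∧ IsCMTypeRealisation Φ₂ B₂ ι₂ θ₂ ∧ IsCMTypeRealisation Φ₃ B₃ ι₃ θ₃ ∧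
          ¬ (Nonempty (K₁ ≃+* K₀) ∧ Nonempty (K₂ ≃+* K₀) ∧ Nonempty (K₃ ≃+* K₀)))
    (hS : ∀ B₀ B₁ B₂ : AbelianVariety ℂ, B₀.IsSimple → B₁.IsSimple → B₂.IsSimple → AVDominatedBy B₀ X → AVDominatedBy B₁ X → AVDominatedBy B₂ X →
      B₀.dim = 2 → B₁.dim = 2 → B₂.dim = 2 → ¬ IsIsogenous B₀ B₁ → ¬ IsIsogenous B₀ B₂ → ¬ IsIsogenous B₁ B₂ →
      ∃ (K₀ : Type) (_ : Field K₀) (_ : NumberField K₀) (_ : IsCMField K₀) (Φ₀ : CMType K₀) (ι₀ : 𝓞 K₀ →+* End B₀) (θ₀ : K₀ →+* Module.End ℂ (complexBetti B₀.X 1))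
        (K₁ : Type) (_ : Field K₁) (_ : NumberField K₁) (_ : IsCMField K₁) (Φ₁ : CMType K₁) (ι₁ : 𝓞 K₁ →+* End B₁) (θ₁ : K₁ →+* Module.End ℂ (complexBetti B₁.X 1))
        (K₂ : Type) (_ : Field K₂) (_ : NumberField K₂) (_ : IsCMField K₂) (Φ₂ : CMType K₂) (ι₂ : 𝓞 K₂ →+* End B₂) (θ₂ : K₂ →+* Module.End ℂ (complexBetti B₂.X 1)),
        IsCMTypeRealisation Φ₀ B₀ ι₀ θ₀ ∧ IsCMTypeRealisation Φ₁ B₁ ι₁ θ₁ ∧ IsCMTypeRealisation Φ₂ B₂ ι₂ θ₂ ∧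
          ¬ (normalClosure ℚ K₀ ℂ = normalClosure ℚ K₁ ℂ ∧ normalClosure ℚ K₁ ℂ = normalClosure ℚ K₂ ℂ))
    {B : AbelianVariety ℂ} {N : ℕ} (hB : AVDominatedBy B (X.powSucc N)) : HodgeConjectureFor B.dim B.X := by
  refine hodgeConjectureFor_of_avDominatedBy_powSucc_of_isOfCMType_of_witnessed_threePerField_of_markman hW4 hcm h3 ?_ hT4 hS hB
  intro B₀ B₁ hs₀ hs₁ hd₀ hd₁ h3₀ h3₁ hni
  obtain ⟨K₀, _, _, _, Φ₀, ι₀, θ₀, K₁, _, _, _, Φ₁, ι₁, θ₁, hA₀, hA₁, hQ⟩ := hT1 B₀ B₁ hs₀ hs₁ hd₀ hd₁ h3₀ h3₁ hni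
  refine ⟨K₀, inferInstance, inferInstance, inferInstance, Φ₀, ι₀, θ₀, K₁, inferInstance, inferInstance, inferInstance, Φ₁, ι₁, θ₁, hA₀, hA₁,
    fun hsh => ?_⟩
  have h6₀ : Module.finrank ℚ K₀ = 6 := by have := Literature.AlgebraicGeometry.Pohlmann1968.finrank_eq_two_mul_dim_of_isCMTypeRealisation hA₀; omega
  have h6₁ : Module.finrank ℚ K₁ = 6 := by have := Literature.AlgebraicGeometry.Pohlmann1968.finrank_eq_two_mul_dim_of_isCMTypeRealisation hA₁; omega
  obtain ⟨F, hF2, hFtc, -⟩ := id hsh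
  exact normalClosure_ne_of_sharedQuadratic_of_isEmpty_ringEquiv h6₀ h6₁ hsh (hQ ⟨F, hF2, hFtc⟩)

end Witnessed

end Summit.HodgeConjecture.CorCM.MultiFieldWeil

end
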